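import Summits.Ventures.HodgeRepro2.T5SU11LegendreCoefficientDecay
import Summits.Ventures.HodgeRepro2.T5SU11LegendreBound
import Mathlib.Analysis.Normed.Group.FunctionSeries
import Mathlib.MeasureTheory.Measure.OpenPos

/-!
# The Legendre series of a `C²` function converges absolutely and uniformly to the function

For `f` twice differentiable on `[−1, 1]` with continuous second derivative (`hf`, `hf'`, `hf''` as in the previous
file) the coefficients `c_k(f)` are absolutely summable (`summable_abs_fourierLegendre`), and with `|P_k| ≤ 1` on
`[−1, 1]` (row 385) the Weierstrass M-test gives the UNIFORM convergence of the Legendre series on `[−1, 1]` to its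
sum `L` (`tendstoUniformlyOn_partialSum_tsum`). Row 420's `L²`-convergence identifies `L` with `f`:
`∫ (f − L)² ≤ 2 ∫ (f − S_d f)² + 2 ∫ (S_d f − L)² → 0`, so `∫ (f − L)² = 0`, and `f − L` is continuous, so `f = L`
on `[−1, 1]` (`eqOn_tsum`). Hence

  **`S_d f → f` uniformly on `[−1, 1]`**   (`tendstoUniformlyOn_partialSum`),
  **`Σ_k c_k(f) P_k(x) = f(x)`** for every `x ∈ [−1, 1]`, absolutely   (`hasSum_fourierLegendre_mul_legP`),
  **`|f(x) − S_d f(x)| ≤ Σ_{k>d} |c_k(f)|`** on `[−1, 1]`   (`abs_sub_partialSum_le`),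

and the same for every `f ∈ C²(ℝ)` with `f′ = deriv f`, `f″ = deriv (deriv f)`
(`tendstoUniformlyOn_partialSum_of_contDiff`, `hasSum_fourierLegendre_mul_legP_of_contDiff`). Nothing is claimed
about (N).

Blind lane: Mathlib + the HodgeRepro2 prefix only; no sorry; axioms ⊆ {propext, Classical.choice,
Quot.sound}.
-/

namespace Summit.Ventures.HodgeRepro2.T5SU11LegendreSeriesUniform

open Polynomial intervalIntegral Finset Filter Topology MeasureTheory
open Set (Icc Ioc Ioo uIcc uIoc EqOn)
open T5SU11SphericalLegendreAll T5SU11LegendreIdentities T5SU11LegendreOrthogonal T5SU11LegendreBound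
  T5SU11LegendreSeries T5SU11LegendreCoefficientDecay

section C2

variable {f f' f'' : ℝ → ℝ}
  (hf : ∀ x ∈ Icc (-1 : ℝ) 1, HasDerivAt f (f' x) x)
  (hf' : ∀ x ∈ Icc (-1 : ℝ) 1, HasDerivAt f' (f'' x) x)
  (hf'' : ContinuousOn f'' (Icc (-1 : ℝ) 1))

/-! ### Uniform convergence and the identification of the limit -/

omit hf hf' hf'' in
/-- The bound `|c_k(f) P_k(x)| ≤ |c_k(f)|` on `[−1, 1]` (row 385's `|P_k| ≤ 1`). -/
theorem norm_term_le (k : ℕ) {x : ℝ} (hx : x ∈ Icc (-1 : ℝ) 1) :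
    ‖fourierLegendre f k * legP k x‖ ≤ |fourierLegendre f k| := by
  rw [Real.norm_eq_abs, abs_mul]
  exact mul_le_of_le_one_right (abs_nonneg _) (abs_legP_le_one k hx)

include hf hf' hf'' in
/-- **The Legendre series converges uniformly on `[−1, 1]` to its sum** (Weierstrass M-test). -/
theorem tendstoUniformlyOn_partialSum_tsum :
    TendstoUniformlyOn (fun d x => partialSum f d x) (fun x => ∑' k, fourierLegendre f k * legP k x) atTop
      (Icc (-1 : ℝ) 1) := by
  have h := tendstoUniformlyOn_tsum_nat (summable_abs_fourierLegendre hf hf' hf'')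
    (f := fun k x => fourierLegendre f k * legP k x) (s := Icc (-1 : ℝ) 1) fun k x hx => norm_term_le k hx
  intro u hu
  exact (tendsto_add_atTop_nat 1).eventually (h u hu)

include hf hf' hf'' in
/-- The sum of the Legendre series is continuous on `[−1, 1]`. -/
theorem continuousOn_tsum_fourierLegendre :
    ContinuousOn (fun x => ∑' k, fourierLegendre f k * legP k x) (Icc (-1 : ℝ) 1) :=
  continuousOn_tsum (fun k => (continuous_const.mul (continuous_legP k)).continuousOn)
    (summable_abs_fourierLegendre hf hf' hf'') fun k _ hx => norm_term_le k hx

include hf hf' hf'' in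
/-- **`∫ (S_d f − L)² → 0`** for the uniform limit `L` of the partial sums. -/
theorem tendsto_integral_partialSum_sub_tsum_sq :
    Tendsto (fun d => ∫ x in (-1 : ℝ)..1, (partialSum f d x - ∑' k, fourierLegendre f k * legP k x) ^ 2) atTop
      (𝓝 0) := by
  set L : ℝ → ℝ := fun x => ∑' k, fourierLegendre f k * legP k x with hL
  have hunif := tendstoUniformlyOn_partialSum_tsum hf hf' hf''
  rw [Metric.tendstoUniformlyOn_iff] at hunif
  rw [Metric.tendsto_atTop]
  intro ε hε
  obtain ⟨N, hN⟩ := (hunif (Real.sqrt (ε / 4)) (Real.sqrt_pos.mpr (by positivity))).exists_forall_of_atTop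
  refine ⟨N, fun d hd => ?_⟩
  rw [Real.dist_eq, sub_zero, abs_of_nonneg (integral_nonneg (by norm_num) fun x _ => sq_nonneg _)]
  have hbound : ∀ x ∈ Set.uIoc (-1 : ℝ) 1, ‖(partialSum f d x - L x) ^ 2‖ ≤ ε / 4 := fun x hx => by
    have hx' : x ∈ Icc (-1 : ℝ) 1 := by
      rw [Set.uIoc_of_le (by norm_num)] at hx
      exact Set.Ioc_subset_Icc_self hx
    rw [Real.norm_eq_abs, abs_of_nonneg (sq_nonneg _), ← sq_abs]
    have h1 := (hN d hd x hx').le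
    rw [Real.dist_eq, abs_sub_comm] at h1
    calc |partialSum f d x - L x| ^ 2 ≤ Real.sqrt (ε / 4) ^ 2 := pow_le_pow_left₀ (abs_nonneg _) h1 2
      _ = ε / 4 := Real.sq_sqrt (by positivity)
  have := norm_integral_le_of_norm_le_const hbound
  rw [Real.norm_eq_abs, abs_of_nonneg (integral_nonneg (by norm_num) fun x _ => sq_nonneg _)] at this
  norm_num at this
  linarith

include hf hf' hf'' in
/-- **`∫ (f − L)² = 0`**: the uniform limit `L` of the Legendre series agrees with `f` in `L²`. -/
theorem integral_sub_tsum_sq_eq_zero :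
    ∫ x in (-1 : ℝ)..1, (f x - ∑' k, fourierLegendre f k * legP k x) ^ 2 = 0 := by
  set L : ℝ → ℝ := fun x => ∑' k, fourierLegendre f k * legP k x with hL
  have hfc : ContinuousOn f (Icc (-1 : ℝ) 1) := continuousOn_of_hasDerivAt hf
  have hLc : ContinuousOn L (Icc (-1 : ℝ) 1) := continuousOn_tsum_fourierLegendre hf hf' hf''
  have hA := tendsto_integral_sub_partialSum_sq hfc
  have hB := tendsto_integral_partialSum_sub_tsum_sq hf hf' hf''
  -- `∫ (f − L)² ≤ 2 ∫ (f − S_d)² + 2 ∫ (S_d − L)²` for every `d`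
  have hle : ∀ d, ∫ x in (-1 : ℝ)..1, (f x - L x) ^ 2
      ≤ 2 * (∫ x in (-1 : ℝ)..1, (f x - partialSum f d x) ^ 2)
        + 2 * ∫ x in (-1 : ℝ)..1, (partialSum f d x - L x) ^ 2 := by
    intro d
    have hS := continuous_partialSum f d
    have i1 : IntervalIntegrable (fun x => (f x - partialSum f d x) ^ 2) volume (-1 : ℝ) 1 :=
      ((hfc.sub hS.continuousOn).pow 2).intervalIntegrable_of_Icc (by norm_num)
    have i2 : IntervalIntegrable (fun x => (partialSum f d x - L x) ^ 2) volume (-1 : ℝ) 1 :=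
      ((hS.continuousOn.sub hLc).pow 2).intervalIntegrable_of_Icc (by norm_num)
    rw [← intervalIntegral.integral_const_mul, ← intervalIntegral.integral_const_mul,
      ← integral_add (i1.const_mul 2) (i2.const_mul 2)]
    refine integral_mono_on (by norm_num) (((hfc.sub hLc).pow 2).intervalIntegrable_of_Icc (by norm_num))
      ((i1.const_mul 2).add (i2.const_mul 2)) fun x _ => ?_
    nlinarith [sq_nonneg (f x - partialSum f d x - (partialSum f d x - L x))]
  have hlim : Tendsto (fun d => 2 * (∫ x in (-1 : ℝ)..1, (f x - partialSum f d x) ^ 2)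
      + 2 * ∫ x in (-1 : ℝ)..1, (partialSum f d x - L x) ^ 2) atTop (𝓝 (2 * 0 + 2 * 0)) :=
    (hA.const_mul 2).add (hB.const_mul 2)
  rw [mul_zero, add_zero] at hlim
  have hnn : 0 ≤ ∫ x in (-1 : ℝ)..1, (f x - L x) ^ 2 := integral_nonneg (by norm_num) fun x _ => sq_nonneg _
  refine le_antisymm (ge_of_tendsto' hlim hle) hnn

include hf hf' hf'' in
/-- **`f = L` on `[−1, 1]`**: the Legendre series of a `C²` function sums to the function. -/
theorem eqOn_tsum : EqOn f (fun x => ∑' k, fourierLegendre f k * legP k x) (Icc (-1 : ℝ) 1) := by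
  set L : ℝ → ℝ := fun x => ∑' k, fourierLegendre f k * legP k x with hL
  have hfc : ContinuousOn f (Icc (-1 : ℝ) 1) := continuousOn_of_hasDerivAt hf
  have hLc : ContinuousOn L (Icc (-1 : ℝ) 1) := continuousOn_tsum_fourierLegendre hf hf' hf''
  have h0 := integral_sub_tsum_sq_eq_zero hf hf' hf''
  have hint : IntervalIntegrable (fun x => (f x - L x) ^ 2) volume (-1 : ℝ) 1 :=
    ((hfc.sub hLc).pow 2).intervalIntegrable_of_Icc (by norm_num)
  have hae := (integral_eq_zero_iff_of_nonneg_ae (Eventually.of_forall fun x => sq_nonneg (f x - L x)) hint).mp h0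
  have hempty : Set.Ioc (1 : ℝ) (-1) = ∅ := Set.Ioc_eq_empty (by norm_num)
  rw [hempty, Set.union_empty, Measure.restrict_congr_set Ioc_ae_eq_Icc] at hae
  have heq : EqOn (fun x => (f x - L x) ^ 2) (0 : ℝ → ℝ) (Icc (-1 : ℝ) 1) :=
    Measure.eqOn_Icc_of_ae_eq (μ := volume) (by norm_num) hae ((hfc.sub hLc).pow 2) continuousOn_const
  intro x hx
  have := heq hx
  simp only [Pi.zero_apply, pow_eq_zero_iff, ne_eq, OfNat.ofNat_ne_zero, not_false_eq_true, sub_eq_zero] at this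
  exact this

include hf hf' hf'' in
/-- **THE LEGENDRE SERIES OF A `C²` FUNCTION CONVERGES UNIFORMLY TO THE FUNCTION ON `[−1, 1]`**:
`S_d f → f` uniformly on `[−1, 1]`. -/
theorem tendstoUniformlyOn_partialSum :
    TendstoUniformlyOn (fun d x => partialSum f d x) f atTop (Icc (-1 : ℝ) 1) :=
  (tendstoUniformlyOn_partialSum_tsum hf hf' hf'').congr_right (eqOn_tsum hf hf' hf'').symm

include hf hf' hf'' in
/-- Pointwise: `S_d f(x) → f(x)` for every `x ∈ [−1, 1]`. -/
theorem tendsto_partialSum {x : ℝ} (hx : x ∈ Icc (-1 : ℝ) 1) :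
    Tendsto (fun d => partialSum f d x) atTop (𝓝 (f x)) :=
  (tendstoUniformlyOn_partialSum hf hf' hf'').tendsto_at hx

include hf hf' hf'' in
/-- **`Σ_k c_k(f) P_k(x) = f(x)`** for every `x ∈ [−1, 1]`, as an absolutely convergent series. -/
theorem hasSum_fourierLegendre_mul_legP {x : ℝ} (hx : x ∈ Icc (-1 : ℝ) 1) :
    HasSum (fun k => fourierLegendre f k * legP k x) (f x) := by
  have hs : Summable (fun k => fourierLegendre f k * legP k x) :=
    Summable.of_norm_bounded (summable_abs_fourierLegendre hf hf' hf'') fun k => norm_term_le k hx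
  rw [eqOn_tsum hf hf' hf'' hx]
  exact hs.hasSum

include hf hf' hf'' in
/-- The uniform error bound: `sup_{[−1,1]} |f − S_d f| ≤ Σ_{k>d} |c_k(f)|`, the tail of the coefficient series. -/
theorem abs_sub_partialSum_le (d : ℕ) {x : ℝ} (hx : x ∈ Icc (-1 : ℝ) 1) :
    |f x - partialSum f d x| ≤ ∑' k, |fourierLegendre f (k + (d + 1))| := by
  have hs : Summable (fun k => fourierLegendre f k * legP k x) :=
    Summable.of_norm_bounded (summable_abs_fourierLegendre hf hf' hf'') fun k => norm_term_le k hx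
  have habs := summable_abs_fourierLegendre hf hf' hf''
  have hsum := hasSum_fourierLegendre_mul_legP hf hf' hf'' hx
  -- `f x − S_d f x = Σ_{k ≥ d+1} c_k P_k(x)`
  have htail : f x - partialSum f d x
      = ∑' k, fourierLegendre f (k + (d + 1)) * legP (k + (d + 1)) x := by
    have h1 := hs.sum_add_tsum_nat_add (d + 1)
    rw [hsum.tsum_eq] at h1
    rw [partialSum]
    linarith
  rw [htail]
  have htail_abs : Summable (fun k => |fourierLegendre f (k + (d + 1))|) :=
    (summable_nat_add_iff (f := fun k => |fourierLegendre f k|) (d + 1)).mpr habs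
  have hF : Summable (fun k => ‖fourierLegendre f (k + (d + 1)) * legP (k + (d + 1)) x‖) :=
    (Summable.of_norm_bounded htail_abs fun k => norm_term_le (k + (d + 1)) hx).norm
  calc |∑' k, fourierLegendre f (k + (d + 1)) * legP (k + (d + 1)) x|
      = ‖∑' k, fourierLegendre f (k + (d + 1)) * legP (k + (d + 1)) x‖ := (Real.norm_eq_abs _).symm
    _ ≤ ∑' k, ‖fourierLegendre f (k + (d + 1)) * legP (k + (d + 1)) x‖ := norm_tsum_le_tsum_norm hF
    _ ≤ ∑' k, |fourierLegendre f (k + (d + 1))| :=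
        Summable.tsum_le_tsum (fun k => norm_term_le (k + (d + 1)) hx) hF htail_abs

end C2

/-! ### Every `C²` function on `ℝ` -/

/-- The derivative data of an `f ∈ C²(ℝ)`: `f′ = deriv f`, `f″ = deriv (deriv f)` on `[−1, 1]`, `f″` continuous. -/
theorem hasDerivAt_of_contDiff {f : ℝ → ℝ} (hf : ContDiff ℝ 2 f) :
    (∀ x ∈ Icc (-1 : ℝ) 1, HasDerivAt f (deriv f x) x) ∧
      (∀ x ∈ Icc (-1 : ℝ) 1, HasDerivAt (deriv f) (deriv (deriv f) x) x) ∧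
        ContinuousOn (deriv (deriv f)) (Icc (-1 : ℝ) 1) := by
  have h1 : ContDiff ℝ 1 (deriv f) := by simpa using hf.iterate_deriv' 1 1
  have h2 : Continuous (deriv (deriv f)) := by simpa using (hf.iterate_deriv' 0 2).continuous
  exact ⟨fun x _ => (hf.differentiable (by norm_num) x).hasDerivAt,
    fun x _ => (h1.differentiable one_ne_zero x).hasDerivAt, h2.continuousOn⟩

/-- **`S_d f → f` uniformly on `[−1, 1]` for every `f ∈ C²(ℝ)`.** -/
theorem tendstoUniformlyOn_partialSum_of_contDiff {f : ℝ → ℝ} (hf : ContDiff ℝ 2 f) :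
    TendstoUniformlyOn (fun d x => partialSum f d x) f atTop (Icc (-1 : ℝ) 1) :=
  let ⟨h1, h2, h3⟩ := hasDerivAt_of_contDiff hf
  tendstoUniformlyOn_partialSum h1 h2 h3

/-- **`Σ_k c_k(f) P_k(x) = f(x)`** on `[−1, 1]` for every `f ∈ C²(ℝ)`. -/
theorem hasSum_fourierLegendre_mul_legP_of_contDiff {f : ℝ → ℝ} (hf : ContDiff ℝ 2 f) {x : ℝ}
    (hx : x ∈ Icc (-1 : ℝ) 1) : HasSum (fun k => fourierLegendre f k * legP k x) (f x) :=
  let ⟨h1, h2, h3⟩ := hasDerivAt_of_contDiff hf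
  hasSum_fourierLegendre_mul_legP h1 h2 h3 hx

end Summit.Ventures.HodgeRepro2.T5SU11LegendreSeriesUniform
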